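import Literature.Computability.QuantumComplexity.PathModelGadgetWords
import Literature.Computability.QuantumComplexity.PathModelWindows
import HarnessLib

/-!
# The two-qubit gadgets on an `N`-qubit code register

Topic `Literature/Computability/QuantumComplexity`; sequel of `PathModelGadgetWords.lean` (words
`g` in the gadget symbols `M, M⁻¹, M', M'⁻¹` act on the eight-strand code words by
`|enc 11⟩ ↦ p(g)|enc 11⟩ + q(g) ℓ'` and fix the other three) and `PathModelWindows.lean`
(locality of window braids). Placing the braid word of `g` on the strands of blocks `a, a+1` of
the `4N`-strand register (`Gadget.bigOp a ha g`), the path-model operator acts on the code states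
`|enc x⟩`, `x : QReg N`, as a CONTROLLED PHASE up to leakage (Aharonov–Arad 2011 §3.2: "the
state of the `8` strands evolves by `ρ(b̃)` and the rest is untouched"):

* `bigOp_mulVec_basisState_encodeBits_of_not` — `|enc x⟩` is FIXED if `(x_a, x_{a+1}) ≠ (1,1)`;
* `bigOp_mulVec_basisState_encodeBits_of_both` — otherwise
  `bigOp |enc x⟩ = p(g) |enc x⟩ + q(g) · spliceIso x a 2 ℓ'`, the leakage term living on
  non-code walks.

## References

* D. Aharonov, I. Arad, New J. Phys. 13 (2011) 035019; arXiv:quant-ph/0605181, §3.2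
  [AharonovArad2011].
-/

noncomputable section

open Matrix

namespace Literature.Computability.QuantumComplexity

open Cryptography QuadraticAlgebra

namespace Gadget

variable {N : ℕ}

/-- An eight-strand letter as a window letter (`r + 2 ≤ 8`). [folklore] -/
def toWin (l : Fin (2 * 4 - 1) × Bool) : {r : ℕ // r + 2 ≤ 2 * 4} × Bool :=
  (⟨l.1.1, by have := l.1.2; omega⟩, l.2)

/-- **The gadget operator on the big register**: the braid word of `g`, placed on the strands of
blocks `a, a+1` (generators `σ_{4a+r}`), as a product of `4N`-strand crossing matrices (operator
order). [cite: AharonovArad2011, §3.2] -/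
def bigOp (a : ℕ) (ha : a + 2 ≤ N) (g : List Sym) : Matrix (QReg (N * 4)) (QReg (N * 4)) ℂ :=
  (((expand g).reverse.map toWin).map fun l =>
    ajlCrossingMatrix 5 (windowGen a l.1.1 (windowGen_lt ha l.1.2), l.2)).prod

/-- The small side of the locality lemma is the eight-strand operator `op (expand g)`. [folklore] -/
theorem smallProd_eq_op (g : List Sym) :
    (((expand g).reverse.map toWin).map fun l =>
      ajlCrossingMatrix 5 ((⟨l.1.1, windowGen_small_lt l.1.2⟩ : Fin (2 * 4 - 1)), l.2)).prod = op (expand g) := by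
  rw [op, List.map_map]
  rfl

/-- **Locality**: `bigOp a g · spliceIso x a = spliceIso x a · op (expand g)`.
[cite: AharonovArad2011, §3.2] -/
theorem bigOp_mul_spliceIso (x : QReg N) {a : ℕ} (ha : a + 2 ≤ N) (g : List Sym) :
    bigOp a ha g * spliceIso x a 2 = spliceIso x a 2 * op (expand g) := by
  rw [bigOp, windowWord_mul_spliceIso x ha, smallProd_eq_op]

/-- The window register of `x` at block `a` is the pair `(x_a, x_{a+1})`. [folklore] -/
theorem encodeBits_window_two (x : QReg N) {a : ℕ} (ha : a + 2 ≤ N) :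
    encodeBits (window x a ha) = enc2 (x ⟨a, by omega⟩) (x ⟨a + 1, by omega⟩) := by
  unfold enc2
  congr 1
  funext j
  unfold window
  match j with
  | ⟨0, _⟩ => simp
  | ⟨1, _⟩ => simp

/-- The eight-strand code words return to vertex `1`. [cite: AharonovArad2011, §3.1] -/
theorem pathPos_enc2 (b₁ b₂ : Bool) : pathPos (enc2 b₁ b₂) (2 * 4) = 1 := by
  have key : ∀ j, j = 4 * 2 → pathPos (enc2 b₁ b₂) j = 1 := fun j hj => by
    subst hj; exact pathPos_encodeBits_mul (N := 2) _ le_rfl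
  exact key _ (by norm_num)

/-- `spliceIso` maps the window code word back to `|enc x⟩`. [cite: AharonovArad2011, §3.2] -/
theorem spliceIso_mulVec_basisState_enc2 (x : QReg N) {a : ℕ} (ha : a + 2 ≤ N) :
    spliceIso x a 2 *ᵥ basisState (enc2 (x ⟨a, by omega⟩) (x ⟨a + 1, by omega⟩)) = basisState (encodeBits x) := by
  rw [spliceIso_mulVec_basisState x ha, if_pos (pathPos_enc2 _ _), ← encodeBits_window_two x ha,
    splice_encodeBits_window x ha]

/-- The big operator on a code state, through the window. [cite: AharonovArad2011, §3.2] -/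
theorem bigOp_mulVec_basisState_encodeBits (x : QReg N) {a : ℕ} (ha : a + 2 ≤ N) (g : List Sym) :
    bigOp a ha g *ᵥ basisState (encodeBits x) =
      spliceIso x a 2 *ᵥ (op (expand g) *ᵥ basisState (enc2 (x ⟨a, by omega⟩) (x ⟨a + 1, by omega⟩))) := by
  rw [← spliceIso_mulVec_basisState_enc2 x ha, mulVec_mulVec, mulVec_mulVec, bigOp_mul_spliceIso x ha]

/-- **Gadget words fix `|enc x⟩` unless `x_a = x_{a+1} = 1`.** [cite: AharonovArad2011, §3.2] -/
theorem bigOp_mulVec_basisState_encodeBits_of_not (x : QReg N) {a : ℕ} (ha : a + 2 ≤ N) (g : List Sym)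
    (h : ¬(x ⟨a, by omega⟩ = true ∧ x ⟨a + 1, by omega⟩ = true)) :
    bigOp a ha g *ᵥ basisState (encodeBits x) = basisState (encodeBits x) := by
  rw [bigOp_mulVec_basisState_encodeBits x ha, op_expand_enc2 g h, spliceIso_mulVec_basisState_enc2 x ha]

/-- **Gadget words on `|enc x⟩` with `x_a = x_{a+1} = 1`**: controlled phase `p(g)` plus leakage
`q(g) · spliceIso ℓ'`. [cite: AharonovArad2011, §3.2] -/
theorem bigOp_mulVec_basisState_encodeBits_of_both (x : QReg N) {a : ℕ} (ha : a + 2 ≤ N) (g : List Sym)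
    (h1 : x ⟨a, by omega⟩ = true) (h2 : x ⟨a + 1, by omega⟩ = true) :
    bigOp a ha g *ᵥ basisState (encodeBits x) =
      K5.toComplex (piVec g).1 • basisState (encodeBits x) + K5.toComplex (piVec g).2 • (spliceIso x a 2 *ᵥ leak) := by
  have hs := spliceIso_mulVec_basisState_enc2 x ha
  rw [h1, h2] at hs
  rw [bigOp_mulVec_basisState_encodeBits x ha, h1, h2, op_expand_enc11, mulVec_add, mulVec_smul, mulVec_smul, hs]

end Gadget

end Literature.Computability.QuantumComplexity

end
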